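import Summits.AnomalousDissipation.AnomalousDissipation.Theorems.MomentParityMomentLadderLine

/-!
# Line `Sketch` of the crux `MomentParity.MomentLadder` (stmt-AnomalousDissipation-11463): the residual is EXACT —
# `GalerkinInvariantLoudUI ↔ MomentLadder`

The landed composition file `Theorems/MomentParityMomentLadderLine.lean` proves the transfer
`MomentLadder_of_galerkinInvariantLoudUI : C⁺ → MomentLadder`, where `C⁺` (= the line's one open registered stub
`stub_galerkinInvariantLoudUI`) is the loud Galerkin-invariant rung with ONE superlinear enstrophy moment `∫ Ψ(‖∇u‖²) dμ ≤ B_j`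
(`Ψ(x)/x → ∞`, the same `Ψ` for every `j`, `B_j` uniform in the level `N`), and the characterization `momentLadder_iff_mod`
(`MomentLadder` ⟺ the loud rung with an `N`-free UI MODULUS `ω_j` of the enstrophy).

This file closes the triangle: a **diagonal de la Vallée-Poussin construction** turns the countably many `N`-free moduli
`ω_j` (one per viscosity) into ONE superlinear staircase `Ψ(x) = x · #{i : T_i < x}` with `∫ Ψ(‖∇u‖²) dμ ≤ B_j < ∞` for every
witnessing law at index `j` (`exists_superlinear_of_uiModuli`), whence

* `galerkinInvariantLoudUI_of_MomentLadder : MomentLadder → C⁺` and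
* `galerkinInvariantLoudUI_iff_MomentLadder : C⁺ ↔ MomentLadder`;
* `galerkinInvariantLoud_of_MomentLadder : MomentLadder → GalerkinInvariantLoud` (the crux implies the sibling crux
  stmt-14283 by name) and its contrapositive `not_MomentLadder_of_not_galerkinInvariantLoud`.

Consequence (numbers, not adjectives): the line `Sketch` is LOSSLESS and COMPLETE — its only open stub is equivalent to the
crux itself; 9 of its 10 registered stubs are landed theorems; what remains is the Galerkin-ensemble zeroth law with a
uniformly integrable enstrophy (sibling crux `GalerkinInvariantLoud`, stmt-14283, plus UI of `‖∇u‖²` along the levels), and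
no re-lining through the card `enstrophy-ui-resolution` can produce a cheaper residual.

References: de la Vallée-Poussin 1915; Fonseca–Leoni, *Modern Methods in the Calculus of Variations* (2007) Thm 2.29;
Foias–Manley–Rosa–Temam (2001) Ch. IV §1.2.
-/

set_option linter.dupNamespace false

noncomputable section

namespace Summit.AnomalousDissipation.AnomalousDissipation.Theorems.MomentLadder

open MeasureTheory Filter Topology Set
open scoped ENNReal NNReal BigOperators
open Literature.Analysis.FunctionSpaces Literature.Analysis.FluidPDE
open Summit.AnomalousDissipation.AnomalousDissipation.Theses.MomentParity
open Summit.AnomalousDissipation.AnomalousDissipation.Theorems.QuarticGate.Negative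
open Summit.AnomalousDissipation.AnomalousDissipation.Theorems.MomentLadder.Negative

/-! ## The staircase `Ψ_T(x) = ∑_i x·𝟙{T_i < x}` (de la Vallée-Poussin) -/

/-- The de la Vallée-Poussin STAIRCASE attached to thresholds `T : ℕ → ℕ`, `Ψ_T x = ∑' i, 𝟙{T i < x} · x` (`x` times the
number of thresholds below `x`; written inline throughout), is superlinear: `Ψ_T x / x → ∞` as `x → ∞` (`x ≠ ∞`), whatever the
thresholds. [folklore] -/
theorem tendsto_staircase_div (T : ℕ → ℕ) :
    Tendsto (fun x : ℝ≥0∞ => (∑' i : ℕ, (Ioi (T i : ℝ≥0∞)).indicator (fun y => y) x) / x) (𝓝[≠] ⊤) (𝓝 ⊤) := by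
  rw [ENNReal.tendsto_nhds_top_iff_nat]
  intro n
  -- beyond `S = ∑_{i ≤ n} T i` the first `n + 1` steps are all active
  set S : ℝ≥0∞ := ∑ i ∈ Finset.range (n + 1), (T i : ℝ≥0∞) with hS
  have hST : S < ⊤ := by
    rw [hS]
    exact ENNReal.sum_lt_top.2 fun i _ => ENNReal.natCast_lt_top (T i)
  have hmem : Ioi S ∈ 𝓝[≠] (⊤ : ℝ≥0∞) := mem_nhdsWithin_of_mem_nhds (Ioi_mem_nhds hST)
  filter_upwards [hmem, self_mem_nhdsWithin] with x hx hxT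
  have hx0 : x ≠ 0 := by
    rintro rfl
    exact ENNReal.not_lt_zero hx
  have hxT' : x ≠ ⊤ := hxT
  -- each of the first `n + 1` steps contributes `x`
  have hstep : ∀ i ∈ Finset.range (n + 1), (Ioi (T i : ℝ≥0∞)).indicator (fun y => y) x = x := by
    intro i hi
    have hTi : (T i : ℝ≥0∞) ≤ S := by
      rw [hS]
      exact Finset.single_le_sum (f := fun i => (T i : ℝ≥0∞)) (fun i _ => (zero_le : (0 : ℝ≥0∞) ≤ T i)) hi
    have hx' : x ∈ Ioi (T i : ℝ≥0∞) := lt_of_le_of_lt hTi hx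
    exact indicator_of_mem hx' _
  have hsum : ((n : ℝ≥0∞) + 1) * x ≤ ∑' i : ℕ, (Ioi (T i : ℝ≥0∞)).indicator (fun y => y) x := by
    calc ((n : ℝ≥0∞) + 1) * x = ∑ i ∈ Finset.range (n + 1), x := by
          simp [Finset.sum_const, Finset.card_range, nsmul_eq_mul]
      _ = ∑ i ∈ Finset.range (n + 1), (Ioi (T i : ℝ≥0∞)).indicator (fun y => y) x :=
          (Finset.sum_congr rfl hstep).symm
      _ ≤ ∑' i : ℕ, (Ioi (T i : ℝ≥0∞)).indicator (fun y => y) x := ENNReal.sum_le_tsum _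
  have hle : (n : ℝ≥0∞) + 1 ≤ (∑' i : ℕ, (Ioi (T i : ℝ≥0∞)).indicator (fun y => y) x) / x := by
    rw [ENNReal.le_div_iff_mul_le (Or.inl hx0) (Or.inl hxT')]
    exact hsum
  exact lt_of_lt_of_le (by simpa using ENNReal.lt_add_right (ENNReal.natCast_ne_top n) one_ne_zero) hle

/-- The staircase moment of a random variable is the sum of its tails over the thresholds. [folklore] -/
theorem lintegral_staircase {α : Type*} [MeasurableSpace α] (T : ℕ → ℕ) (μ : Measure α)
    {Z : α → ℝ≥0∞} (hZ : Measurable Z) :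
    ∫⁻ u, ∑' i : ℕ, (Ioi (T i : ℝ≥0∞)).indicator (fun y => y) (Z u) ∂μ =
      ∑' i : ℕ, ∫⁻ u in {u | (T i : ℝ≥0∞) < Z u}, Z u ∂μ := by
  have hterm : ∀ i : ℕ, (fun u => (Ioi (T i : ℝ≥0∞)).indicator (fun y => y) (Z u)) =
      {u | (T i : ℝ≥0∞) < Z u}.indicator Z := by
    intro i
    funext u
    exact (indicator_comp_right (s := Ioi (T i : ℝ≥0∞)) Z (g := fun y => y) (x := u)).symm
  have hmeas : ∀ i : ℕ, MeasurableSet {u | (T i : ℝ≥0∞) < Z u} := fun i =>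
    measurableSet_lt measurable_const hZ
  rw [lintegral_tsum fun i => ?_]
  · congr 1
    funext i
    rw [show (fun u => (Ioi (T i : ℝ≥0∞)).indicator (fun y => y) (Z u)) =
        {u | (T i : ℝ≥0∞) < Z u}.indicator Z from hterm i, lintegral_indicator (hmeas i)]
  · rw [hterm i]
    exact (hZ.indicator (hmeas i)).aemeasurable

/-- Mean bound from a tail bound: on a probability space, `∫ Z ≤ M + ∫_{Z > M} Z`. [folklore] -/
theorem lintegral_le_add_tail {α : Type*} [MeasurableSpace α] (μ : Measure α) [IsProbabilityMeasure μ]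
    {Z : α → ℝ≥0∞} (hZ : Measurable Z) (M : ℕ) :
    ∫⁻ u, Z u ∂μ ≤ (M : ℝ≥0∞) + ∫⁻ u in {u | (M : ℝ≥0∞) < Z u}, Z u ∂μ := by
  have hmeas : MeasurableSet {u | (M : ℝ≥0∞) < Z u} := measurableSet_lt measurable_const hZ
  have hpt : ∀ u, Z u ≤ (M : ℝ≥0∞) + {u | (M : ℝ≥0∞) < Z u}.indicator Z u := by
    intro u
    by_cases hu : (M : ℝ≥0∞) < Z u
    · rw [indicator_of_mem (show u ∈ {u | (M : ℝ≥0∞) < Z u} from hu)]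
      exact le_add_self
    · rw [indicator_of_notMem (show u ∉ {u | (M : ℝ≥0∞) < Z u} from hu), add_zero]
      exact not_lt.1 hu
  calc ∫⁻ u, Z u ∂μ ≤ ∫⁻ u, (M : ℝ≥0∞) + {u | (M : ℝ≥0∞) < Z u}.indicator Z u ∂μ := lintegral_mono hpt
    _ = (∫⁻ _u, (M : ℝ≥0∞) ∂μ) + ∫⁻ u, {u | (M : ℝ≥0∞) < Z u}.indicator Z u ∂μ :=
        lintegral_add_left measurable_const _
    _ = (M : ℝ≥0∞) + ∫⁻ u in {u | (M : ℝ≥0∞) < Z u}, Z u ∂μ := by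
        rw [lintegral_const, measure_univ, mul_one, lintegral_indicator hmeas]

/-! ## Diagonal de la Vallée-Poussin: countably many UI moduli ⇒ ONE superlinear moment -/

/-- **Diagonal de la Vallée-Poussin.** Given countably many `N`-free UI moduli `ω j` (`ω j M → 0` as `M → ∞`), there is ONE
superlinear `Ψ` (`Ψ x / x → ∞`) and, for every `j`, a bound `B_j < ∞` such that every random variable `Z` on a probability space
whose tails are dominated by `ω j` (`∫_{Z > M} Z ≤ ω j M` for all `M`) has `∫ Ψ(Z) ≤ B_j`. Construction: thresholds `M j i` with
`ω j (M j i) ≤ 2^{-i}`, diagonal thresholds `T i = ∑_{j ≤ i} M j i`, `Ψ` = the staircase of `T` (`tendsto_staircase_div`, `lintegral_staircase`); for `i ≥ j` the `i`-th tail is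
`≤ 2^{-i}`, for `i < j` it is at most the mean `≤ M j 0 + 1`; `B_j = j (M j 0 + 1) + 2`. [folklore] -/
theorem exists_superlinear_of_uiModuli {α : Type*} [MeasurableSpace α] (ω : ℕ → ℕ → ℝ≥0∞)
    (hω : ∀ j, Tendsto (ω j) atTop (𝓝 0)) :
    ∃ Ψ : ℝ≥0∞ → ℝ≥0∞, Tendsto (fun x : ℝ≥0∞ => Ψ x / x) (𝓝[≠] ⊤) (𝓝 ⊤) ∧
      ∀ j : ℕ, ∃ B : ℝ≥0∞, B < ⊤ ∧ ∀ (μ : Measure α) [IsProbabilityMeasure μ] (Z : α → ℝ≥0∞), Measurable Z →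
        (∀ M : ℕ, ∫⁻ u in {u | (M : ℝ≥0∞) < Z u}, Z u ∂μ ≤ ω j M) → ∫⁻ u, Ψ (Z u) ∂μ ≤ B := by
  -- thresholds `M j i` with `ω j (M j i) ≤ 2⁻¹ ^ i`
  have hthr : ∀ j i : ℕ, ∃ M : ℕ, ω j M ≤ (2⁻¹ : ℝ≥0∞) ^ i := by
    intro j i
    have hpos : (0 : ℝ≥0∞) < (2⁻¹ : ℝ≥0∞) ^ i := ENNReal.pow_pos (by simp) i
    obtain ⟨M, hM⟩ := (ENNReal.tendsto_atTop_zero.1 (hω j)) _ hpos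
    exact ⟨M, hM M le_rfl⟩
  choose M hM using hthr
  -- diagonal thresholds
  set T : ℕ → ℕ := fun i => ∑ j ∈ Finset.range (i + 1), M j i with hT
  have hMT : ∀ j i : ℕ, j ≤ i → M j i ≤ T i := by
    intro j i hji
    rw [hT]
    exact Finset.single_le_sum (f := fun j => M j i) (fun _ _ => Nat.zero_le _)
      (Finset.mem_range.2 (Nat.lt_succ_of_le hji))
  refine ⟨fun x => ∑' i : ℕ, (Ioi (T i : ℝ≥0∞)).indicator (fun y => y) x, tendsto_staircase_div T, fun j => ?_⟩
  -- the bound at index `j`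
  set C : ℝ≥0∞ := (M j 0 : ℝ≥0∞) + 1 with hC
  refine ⟨(j : ℝ≥0∞) * C + 2, ?_, fun μ _ Z hZ htail => ?_⟩
  · have hCT : C < ⊤ := by
      rw [hC]; exact ENNReal.add_lt_top.2 ⟨ENNReal.natCast_lt_top _, ENNReal.one_lt_top⟩
    exact ENNReal.add_lt_top.2 ⟨ENNReal.mul_lt_top (ENNReal.natCast_lt_top j) hCT, ENNReal.ofNat_lt_top⟩
  beta_reduce
  rw [lintegral_staircase T μ hZ]
  -- termwise domination: `a i ≤ 𝟙{i < j} C + 2⁻¹ ^ i`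
  have hmean : ∫⁻ u, Z u ∂μ ≤ C := by
    refine (lintegral_le_add_tail μ hZ (M j 0)).trans ?_
    rw [hC]
    gcongr
    simpa using (htail (M j 0)).trans (hM j 0)
  have hdom : ∀ i : ℕ, ∫⁻ u in {u | (T i : ℝ≥0∞) < Z u}, Z u ∂μ ≤
      (↑(Finset.range j) : Set ℕ).indicator (fun _ => C) i + (2⁻¹ : ℝ≥0∞) ^ i := by
    intro i
    by_cases hij : i < j
    · rw [indicator_of_mem (show i ∈ (↑(Finset.range j) : Set ℕ) from by simpa using hij)]
      calc ∫⁻ u in {u | (T i : ℝ≥0∞) < Z u}, Z u ∂μ ≤ ∫⁻ u, Z u ∂μ := setLIntegral_le_lintegral _ _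
        _ ≤ C := hmean
        _ ≤ C + (2⁻¹ : ℝ≥0∞) ^ i := le_self_add
    · rw [indicator_of_notMem (show i ∉ (↑(Finset.range j) : Set ℕ) from by simpa using hij), zero_add]
      have hji : j ≤ i := not_lt.1 hij
      calc ∫⁻ u in {u | (T i : ℝ≥0∞) < Z u}, Z u ∂μ
          ≤ ∫⁻ u in {u | (M j i : ℝ≥0∞) < Z u}, Z u ∂μ := by
            refine lintegral_mono_set fun u hu => ?_
            have hu' : (T i : ℝ≥0∞) < Z u := hu
            exact lt_of_le_of_lt (by exact_mod_cast hMT j i hji) hu'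
        _ ≤ ω j (M j i) := htail (M j i)
        _ ≤ (2⁻¹ : ℝ≥0∞) ^ i := hM j i
  calc ∑' i, ∫⁻ u in {u | (T i : ℝ≥0∞) < Z u}, Z u ∂μ
      ≤ ∑' i, ((↑(Finset.range j) : Set ℕ).indicator (fun _ => C) i + (2⁻¹ : ℝ≥0∞) ^ i) :=
        ENNReal.tsum_le_tsum hdom
    _ = (∑' i, (↑(Finset.range j) : Set ℕ).indicator (fun _ => C) i) + ∑' i, (2⁻¹ : ℝ≥0∞) ^ i :=
        ENNReal.tsum_add
    _ = (j : ℝ≥0∞) * C + 2 := by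
        rw [ENNReal.tsum_geometric_two,
          tsum_eq_sum (s := Finset.range j) (fun i hi => indicator_of_notMem (by simpa using hi) _),
          Finset.sum_congr rfl (fun i hi => indicator_of_mem
            (show i ∈ (↑(Finset.range j) : Set ℕ) from by simpa using hi) (fun _ => C))]
        simp

/-! ## `MomentLadder → C⁺`, and the equivalence -/

/-- **`MomentLadder → GalerkinInvariantLoudUI`** (the converse of the landed transfer `MomentLadder_of_galerkinInvariantLoudUI`).
From `mod_of_MomentLadder` (moment closure at every degree, resolution ⇒ UI with an `N`-free modulus `ω_j`) and the diagonal
de la Vallée-Poussin construction: ONE superlinear `Ψ` for all `j`, with `∫ Ψ(‖∇u‖²) dμ ≤ B_j` for every witnessing law at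
index `j`, uniformly in the level `N`. [folklore] -/
theorem galerkinInvariantLoudUI_of_MomentLadder (h : MomentLadder) :
    ∃ f : UnitAddTorus (Fin 3) → EuclideanSpace ℝ (Fin 3),
      Torus.IsSmooth f ∧ Torus.IsDivFree f ∧ Torus.HasZeroMean f ∧
      ∃ (ν : ℕ → ℝ) (E ε : ℝ) (Ψ : ℝ≥0∞ → ℝ≥0∞),
        (∀ j, 0 < ν j) ∧ Tendsto ν atTop (𝓝 0) ∧ 0 < ε ∧
        Tendsto (fun x : ℝ≥0∞ => Ψ x / x) (𝓝[≠] ⊤) (𝓝 ⊤) ∧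
        ∀ j : ℕ, ∃ (R : ℝ) (B : ℝ≥0∞), B < ⊤ ∧ ∃ᶠ N in atTop,
          ∃ μ : Measure (Torus.energySpace (Fin 3)),
            IsProbabilityMeasure μ ∧ (∀ᵐ u ∂μ, IsLevel N u) ∧ IsSupported R μ ∧
            (∀ d, IsPolyStationary (ν j) f N d μ) ∧
            ∫⁻ u, Ψ (Torus.eGradNormSq (u.1 : UnitAddTorus (Fin 3) → EuclideanSpace ℝ (Fin 3))) ∂μ ≤ B ∧
            Torus.ensembleEnergy μ ≤ E ∧ ε ≤ Torus.ensembleDissipation (ν j) μ := by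
  obtain ⟨f, hfs, hfd, hfz, ν, E, ε, hν, hν0, hε, hj⟩ := mod_of_MomentLadder h
  choose R ω hω0 hfreq using hj
  obtain ⟨Ψ, hΨ, hB⟩ := exists_superlinear_of_uiModuli (α := Torus.energySpace (Fin 3)) ω hω0
  refine ⟨f, hfs, hfd, hfz, ν, E, ε, Ψ, hν, hν0, hε, hΨ, fun j => ?_⟩
  obtain ⟨B, hBT, hBdom⟩ := hB j
  refine ⟨R j, B, hBT, (hfreq j).mono fun N hN => ?_⟩
  obtain ⟨μ, hP, hlev, hsupp, hstat, hmod, hE, hεle⟩ := hN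
  exact ⟨μ, hP, hlev, hsupp, hstat,
    hBdom μ (fun u => Torus.eGradNormSq (u.1 : UnitAddTorus (Fin 3) → EuclideanSpace ℝ (Fin 3)))
      Torus.measurable_eGradNormSq_coe hmod, hE, hεle⟩

/-- **The residual of line `Sketch` is exact: `GalerkinInvariantLoudUI ↔ MomentLadder`.** The one open registered stub of the line
(`stub_galerkinInvariantLoudUI`, the loud Galerkin-invariant rung with one superlinear enstrophy moment, `N`-uniform) is EQUIVALENT to
the crux `MomentParity.MomentLadder`: `→` is the landed transfer (weighted palinstrophy bound + spectral gap + de la Vallée-Poussin),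
`←` is `galerkinInvariantLoudUI_of_MomentLadder`. Unconditional; credits no item (both sides open). [folklore] -/
theorem galerkinInvariantLoudUI_iff_MomentLadder :
    (∃ f : UnitAddTorus (Fin 3) → EuclideanSpace ℝ (Fin 3),
      Torus.IsSmooth f ∧ Torus.IsDivFree f ∧ Torus.HasZeroMean f ∧
      ∃ (ν : ℕ → ℝ) (E ε : ℝ) (Ψ : ℝ≥0∞ → ℝ≥0∞),
        (∀ j, 0 < ν j) ∧ Tendsto ν atTop (𝓝 0) ∧ 0 < ε ∧
        Tendsto (fun x : ℝ≥0∞ => Ψ x / x) (𝓝[≠] ⊤) (𝓝 ⊤) ∧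
        ∀ j : ℕ, ∃ (R : ℝ) (B : ℝ≥0∞), B < ⊤ ∧ ∃ᶠ N in atTop,
          ∃ μ : Measure (Torus.energySpace (Fin 3)),
            IsProbabilityMeasure μ ∧ (∀ᵐ u ∂μ, IsLevel N u) ∧ IsSupported R μ ∧
            (∀ d, IsPolyStationary (ν j) f N d μ) ∧
            ∫⁻ u, Ψ (Torus.eGradNormSq (u.1 : UnitAddTorus (Fin 3) → EuclideanSpace ℝ (Fin 3))) ∂μ ≤ B ∧
            Torus.ensembleEnergy μ ≤ E ∧ ε ≤ Torus.ensembleDissipation (ν j) μ) ↔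
    MomentLadder :=
  ⟨MomentLadder_of_galerkinInvariantLoudUI, galerkinInvariantLoudUI_of_MomentLadder⟩

/-! ## The crux sits above the sibling crux `GalerkinInvariantLoud` (stmt-AnomalousDissipation-14283) -/

/-- **`MomentParity.MomentLadder → MomentParity.GalerkinInvariantLoud`** — unconditional implication between two route
declarations (both open cruxes): the target of route MomentParity implies its top crux, the Galerkin-ensemble zeroth law
(stmt-14283), by `galerkinInvariantLoudUI_of_MomentLadder` and forgetting the moment clause
(`galerkinInvariantLoud_of_galerkinInvariantLoudUI`). Hence any refutation of 14283 refutes the crux, and every proof of the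
crux proves 14283: `MomentLadder = GalerkinInvariantLoud + (UI of ‖∇u‖² along the levels)`. Credits no item. [folklore] -/
theorem galerkinInvariantLoud_of_MomentLadder : MomentLadder → GalerkinInvariantLoud :=
  fun h => galerkinInvariantLoud_of_galerkinInvariantLoudUI (galerkinInvariantLoudUI_of_MomentLadder h)

/-- Contrapositive, for the negatives index: `¬ GalerkinInvariantLoud → ¬ MomentLadder`. [folklore] -/
theorem not_MomentLadder_of_not_galerkinInvariantLoud (h : ¬ GalerkinInvariantLoud) : ¬ MomentLadder :=
  fun hM => h (galerkinInvariantLoud_of_MomentLadder hM)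

end Summit.AnomalousDissipation.AnomalousDissipation.Theorems.MomentLadder

end
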